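/-
Copyright (c) 2026 the pub-hodgecm-mathlib formalisation cell (harness21).  Prover seat hodgecm-mathlib-LH4-p07 (g12): Track B «K2-LIT» valve hand,
hLiu418 = stmt-HodgeConjecture-24832; LEAD F0P6-plan (g15) RULING M-160f + BATCH #227 «(σ-A) mini-road, brick [A3]»; (σ-A) road desk K2Liu-p25 (g3),
[A1] K2Liu-p09 (g9) (SIG-SHAPE 2026-09-05T01:29:47Z), [A2] K2Liu-p12 (g6) ∕ K2Liu-p23 (g3), second reader F0P2-p11 (g3).
-/
import Summits.HodgeConjecture.HodgeConjecture.Theorems.K2LiuRankOneStageIntegralsAtHalf   -- [A3] FILE 1 (this seat): null-cone ball limit + stage bookkeeping at `s₀ = ½`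
import HarnessLib

/-!
# Crux `HLiu418`, road `K2_Liu`, #42S BLOCK D row D-2, (σ-A) brick [A3] FILE 2: THE `s₀ = ½` PACKAGE OF ★ `chainValues_of_placeLetter` AND THE HYPOTHESIS-FIRST
# JUNCTION OF STAGE A WITH THE SCHRÖDINGER-MODEL WORD OF [A1]∕[A2]

Cell `hodgecm-mathlib`, crux item hLiu418 = `stmt-HodgeConjecture-24832`; squad K2 ∕ K2Liu (L1); prover LH4-p07 (g12).  THEOREMS ONLY (no `def`, no `instance`, no
`notation`, no named-fact hypothesis, no `sorry`, default heartbeats); lane `--supports stmt-HodgeConjecture-24832 --as helper` (count-neutral helper; closes no socket).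

* §1 **`chainValues_half_of_placeLetter`** — ★ `chainValues_of_placeLetter` (F0P2-p11, ★ p863595) RE-ISSUED AT `s₀ = ½` over its OWN binders VERBATIM: the package
  `(cN, N₁, N₂)` with (c)(d′)(e′) unchanged PLUS (g) `N₂ (1∕2) g = L_F(2)⁻¹·L_{E∕F}(1)⁻¹·∫_ζ ∫_y f (1∕2) (φ(w₂)·φ(u(yδ))·(φ(w₁)·φ(u⁻(ζe_w))·g)) dμF dμw` for every `g`
  and (h) `Gn′ (1∕2) h = cN · ∫_{x ∈ 𝔭^{−k}} conj ψ(σx) · ∫_ζ ∫_y f (1∕2) (…·(φ(w₂)·φ(u(xδ))·h)) dμF dμw dμF(x)` for `k ≥ k₀(h)` — the corner value of the (K1a-3) place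
  letter is `cN` times an honest triple integral of the SECTION AT `½` (FILE 1 §2: the `L`-normalisations cancel).
* §2 **`stageA_half_of_word`** — HYPOTHESIS-FIRST on [A1]+[A2] (K2Liu-p09 (g9) SIG-SHAPE (W-u) `unipOpPi`, (W-w₂) `γ₂ • (𝓕_{x′} ⊠ 1) ∘ leviOpPi B₂`; their value at
  `0` is a Gauss transform): if the section at `½` satisfies the multiplier WORD `hword : ∀ y, f (1∕2) (φ(w₂)·φ(u(yδ))·g) = γ · ∫ x, Ψ x · ψ′(y·Q x) dμX^ι` for SOME
  letters `γ Ψ Q ψ′ μX` (abstract here; [A1]∕[A2] instantiate them: `Ψ` = the `e₂`-block slice of `ω(g)Φ` after `leviOpPi B₂`, `Q` the Gram form of `c_{t ⊗ 1}` on that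
  block, `ψ′` the Weil-representation character), then (d′) gives `N₁ (1∕2) g = L_F(2)⁻¹ · γ · ∫_y (∫ x, Ψ x · ψ′(y·Q x) dμX^ι) dμF`.
* §3 **`tendsto_ballAverage_stageA_half_of_word`** — with §2's letters made honest (`Q` a non-degenerate quadratic form on `K^ι`, `3 ≤ card ι`, `Ψ ∈ 𝒮(K^ι)`, `ψ′` of
  conductor exponent `d′`, `μX = μF`): `L_F(2)⁻¹·γ·selfDualConst μF d′·μF(𝔭^k)⁻¹·∫ Ψ·1_{𝔭^k}(Q) ⟶ N₁ (1∕2) g` — STAGE A AT `½` IS `γ∕L_F(2)` TIMES THE FIBRE DENSITY OF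
  THE NULL CONE OF `Q` AT ITS VERTEX (FILE 1 §1, Weil 1965 Prop. 6 at `b₀ = 0`; `r = 6 ≥ 3` in the application).
* §4 **`integral_coe_unipOpPi_smul_comp`** (Rao's currency, [A1]-byte-free): `∫ x, (unipOpPi (y • c) Θ)(L x) dμ^ι = ∫ x, Θ(L x)·ψ(y·(−halfForm c (L x))) dμ^ι` — the
  integrand of ★ `K2LiuTensorMiddleCellHaarDelta.exists_ne_zero_swSectionTensorLoc_flip_mul_nElem_eq_integral` ((M2a-C2a), the shape [A1] §3 keys on per K2Liu-p09
  2026-09-05T01:35:56Z) IS §2's `hword` integrand with `Ψ := Θ ∘ L`, `Q := −halfForm c ∘ L`, once the skew parameter is linear in `y` (`c_{t_y} = y • c`).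
NOT here: the words themselves ([A1]), the partial Fourier ∕ tensor splitting ([A2]), the line word and `hWfun` ([A4]); the `ζ`-stage (stage B) closed form waits on
[A1]'s Levi coordinates for `φ(w₁)`, `φ(u⁻(ζ))` and is typed the same hypothesis-first way in a sequel.
HONEST LABEL.  `HC_CM` is proved only modulo the 7 printed citations (2 remaining named inputs: hLiu418 = `stmt-HodgeConjecture-24832`,
h413 = `stmt-HodgeConjecture-24833`) until rung 0 closes; count-neutral helper, closes no socket; `hWfun`∕`hseam` stay BY VALUE (R2) per RULING M-160f.

## References
* [Weil1965] A. Weil, Acta Math. 113 (1965), Chap. III n° 36 Prop. 6 (p. 54).   * [KudlaRallis1994] S. Kudla, S. Rallis, Ann. of Math. 140 (1994), §2, §5 (5.3)–(5.6).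
* [Casselman1980] W. Casselman, Compositio Math. 40 (1980), §3 Thm. 3.1.   * [KudlaSweet1997] S. Kudla, W. J. Sweet, Israel J. Math. 98 (1997), §1.
* [Rangarao1993] R. Ranga Rao, Pacific J. Math. 157 (1993), Lemma 3.2 (3.8), (3.9) (the operators `unipOpPi`, `leviOpPi`, `fourierOpPi`).
-/

set_option autoImplicit false
set_option linter.dupNamespace false -- the mandated namespace repeats `HodgeConjecture.HodgeConjecture`

noncomputable section

namespace Summit.HodgeConjecture.HodgeConjecture.Cruxes.HLiu418.K2LiuRankOneStageIntegralsAtHalfWords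

section StageHalf


open scoped Classical NNReal ENNReal ComplexConjugate
open NumberField IsDedekindDomain Matrix MeasureTheory Topology
open Literature.NumberTheory.GaloisRepresentations.IsNonarchimedeanLocalField
open Literature.NumberTheory.Automorphic Literature.NumberTheory.Automorphic.UnitaryGroup
open Literature.NumberTheory.GelbartRogawski1991.AdaptedBlocks
open Literature.NumberTheory.GelbartRogawski1991.UnitaryDualPair.LocalSplitting
open Literature.NumberTheory.K2Lit.LocalSiegelDoubled
open Summit.HodgeConjecture.HodgeConjecture.Cruxes.HLiu418.K2LiuQRationalDefs
open Summit.HodgeConjecture.HodgeConjecture.Cruxes.HLiu418.K2LiuQRationalLFactor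
open Summit.HodgeConjecture.HodgeConjecture.Cruxes.HLiu418.K2LiuLocalLFactorDefs
open Summit.HodgeConjecture.HodgeConjecture.Cruxes.HLiu418.K2LiuLocalSiegelIwasawaFrame
open Summit.HodgeConjecture.HodgeConjecture.Cruxes.HLiu418.K2LiuLocalSiegelIwasawa
open Summit.HodgeConjecture.HodgeConjecture.Cruxes.HLiu418.K2LiuDoubledUTwoTwoBorelFrame
open Summit.HodgeConjecture.HodgeConjecture.Cruxes.HLiu418.K2LiuDoubledUTwoTwoWeylCocycle
open Summit.HodgeConjecture.HodgeConjecture.Cruxes.HLiu418.K2LiuDoubledUTwoTwoLevi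
open Summit.HodgeConjecture.HodgeConjecture.Cruxes.HLiu418.K2LiuDoubledUTwoTwoFrameTransport
open Summit.HodgeConjecture.HodgeConjecture.Cruxes.HLiu418.K2LiuDoubledUTwoTwoUnipotentCoordinates
open Summit.HodgeConjecture.HodgeConjecture.Cruxes.HLiu418.K2LiuDoubledUTwoTwoUnipotentHaar
open Summit.HodgeConjecture.HodgeConjecture.Cruxes.HLiu418.K2LiuDoubledUTwoTwoLeviTransport
open Summit.HodgeConjecture.HodgeConjecture.Cruxes.HLiu418.K2LiuUnipDeltaRankOneCoordinates
open Summit.HodgeConjecture.HodgeConjecture.Cruxes.HLiu418.K2LiuSiegelCocycleLetters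
open Summit.HodgeConjecture.HodgeConjecture.Cruxes.HLiu418.K2LiuSiegelCocycleStageLetters
open Summit.HodgeConjecture.HodgeConjecture.Cruxes.HLiu418.K2LiuSiegelCocycleStageShort
open Summit.HodgeConjecture.HodgeConjecture.Cruxes.HLiu418.K2LiuSiegelCocycleChainShort
open Summit.HodgeConjecture.HodgeConjecture.Cruxes.HLiu418.K2LiuSiegelCocycleChainLong
open Summit.HodgeConjecture.HodgeConjecture.Cruxes.HLiu418.K2LiuIteratedRankOneCocycle
open Summit.HodgeConjecture.HodgeConjecture.Cruxes.HLiu418.K2LiuSiegelIntertwiningCocycle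
open Summit.HodgeConjecture.HodgeConjecture.Cruxes.HLiu418.K2LiuRankOneStage
open Summit.HodgeConjecture.HodgeConjecture.Cruxes.HLiu418.K2LiuRankOneStageTwisted
open Summit.HodgeConjecture.HodgeConjecture.Cruxes.HLiu418.K2LiuFlatSiegelFamilies
open Summit.HodgeConjecture.HodgeConjecture.Cruxes.HLiu418.K2LiuLocalRingPlaceDecomposition
open Summit.HodgeConjecture.HodgeConjecture.Cruxes.HLiu418.K2LiuRankOneStagePlaceLetterValues

variable (F : Type) [Field F] [NumberField F] (E : Type) [Field E] [NumberField E] [Algebra F E]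
  [Algebra.IsQuadraticExtension F E] (c : E ≃ₐ[F] E)
  {δ : E} (hcδ : c δ = -δ) (hδ : δ ≠ 0) {d : F} (hd : δ * δ = algebraMap F E d) (v : HeightOneSpectrum (𝓞 F))
  {T₂ : Matrix (Fin 2) (Fin 2) F} (hT₂ : T₂.IsSymm) {J₂D : Matrix (Fin (2 + 2)) (Fin (2 + 2)) E} (hJ₂D : J₂D = (gramD F 2 T₂).map (algebraMap F E))
  (D Dinv : Matrix (Fin 2) (Fin 2) F) (hDD : D * Dinv = 1) (hDD' : Dinv * D = 1) (Q : GL (Fin (2 + 2)) F)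
  (hQm : (Q : Matrix (Fin (2 + 2)) (Fin (2 + 2)) F) = Matrix.reindex (e₂ 2) (e₂ 2) (Matrix.fromBlocks 1 D 1 (-D)))
  (hQ : (Q : Matrix (Fin (2 + 2)) (Fin (2 + 2)) F)ᵀ * gramD F 2 T₂ * (Q : Matrix (Fin (2 + 2)) (Fin (2 + 2)) F) = (StdForm.antidiagonal (2 + 2)).over F)

open Summit.HodgeConjecture.HodgeConjecture.Cruxes.HLiu418.K2LiuRankOneStageIntegralsAtHalf
open Filter

/-! ## §1 The `s₀ = ½` package of ★ `chainValues_of_placeLetter` (non-split place) -/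

include hcδ hδ hd hT₂ hDD hQm hQ in
/-- **THE (K1a-3) CHAIN VALUES AT `s₀ = ½`, NON-SPLIT PLACE** — binders = ★ `chainValues_of_placeLetter` VERBATIM; conclusion = its package `(cN, N₁, N₂)` with (c)(d′)(e′)
unchanged, PLUS **(g) for every `g`: `N₂ (1∕2) g = L_F(2,χ_F)_v⁻¹ · L_{E∕F}(1,χ_F∘N)_v⁻¹ · ∫_ζ ∫_y f (1∕2) (φ(w₂)·φ(u_{2e₂}(ι y δ))·(φ(w₁)·φ(u⁻(ζ e_w))·g)) dμF dμw`** and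
**(h) for every `h` ONE threshold `k₀` with `Gn′ (1∕2) h = cN · ∫_{x ∈ 𝔭^{−k}} conj ψ(σx) · ∫_ζ ∫_y f (1∕2) (φ(w₂)·φ(u(yδ))·(φ(w₁)·φ(u⁻(ζe_w))·(φ(w₂)·φ(u(xδ))·h))) dμF dμw dμF(x)`
for all `k ≥ k₀`** — the (d′)(e′) normalisations cancel against (f′)'s prefactor at `s₀ = ½` (FILE 1 §2).  So the continued bad-place factor `W X h v := Gn′_v(½, h_v)` is
`cN` times a ball integral of honest `(ζ, y)`-integrals of the section AT `½`. [cite: Casselman1980, §3 Thm. 3.1] [cite: KudlaRallis1994, §2] [cite: KudlaSweet1997, §1] -/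
theorem chainValues_half_of_placeLetter
    [MeasurableSpace (unipDeltaLocal F E c v 2 (JD := J₂D))] [BorelSpace (unipDeltaLocal F E c v 2 (JD := J₂D))]
    (νN : Measure (unipDeltaLocal F E c v 2 (JD := J₂D))) [νN.IsHaarMeasure]
    (χv : ∀ w : PlacesOver E v, (w.1.adicCompletion E)ˣ →* ℂˣ) (hχ : ∀ (w' : PlacesOver E v) (x : (w'.1.adicCompletion E)ˣ), ‖((χv w' x : ℂˣ) : ℂ)‖ = 1)
    (K₀ : Subgroup (UnitaryGroup.localPi E c (2 + 2) J₂D v))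
    (hK₀ : IsCompact (K₀ : Set (UnitaryGroup.localPi E c (2 + 2) J₂D v)) ∧ IsOpen (K₀ : Set (UnitaryGroup.localPi E c (2 + 2) J₂D v)))
    (hIw : ∀ g : UnitaryGroup.localPi E c (2 + 2) J₂D v, ∃ p, IsSiegelDelta F E c hcδ hδ hd v 2 hT₂ hJ₂D p ∧ ∃ k ∈ K₀, g = p * k)
    (f : ℂ → UnitaryGroup.localPi E c (2 + 2) J₂D v → ℂ) (hSieg : ∀ s, IsLocalSiegelSection F E c hcδ hδ hd v 2 hT₂ hJ₂D χv s (f s)) (hsm : ∀ s, IsSmooth F E c v 2 (f s))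
    (hflat : ∀ s s' : ℂ, ∀ k ∈ K₀, f s k = f s' k)
    (e3 : (v.adicCompletion F × UnitaryGroup.LocalRing E v × v.adicCompletion F) ≃ₜ unipDeltaLocal F E c v 2 (JD := J₂D))
    (he3 : ∀ b₁ z b₂, ((e3 (b₁, z, b₂) : unipDeltaLocal F E c v 2 (JD := J₂D)) : UnitaryGroup.localPi E c (2 + 2) J₂D v) =
      FrameTransport.frameConj F E c v (2 + 2) hJ₂D (antidiagonal_over_eq_map F E 2) Q hQ
        (toLocalFour F E c v (nSiegel (UnitaryGroup.LocalRing E v) (UnitaryGroup.conjLocal E c v) (UnitaryGroup.conjLocal_conjLocal c v hcδ hδ)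
          (UnitaryGroup.toLocalRing E v b₁ * algebraMap E (UnitaryGroup.LocalRing E v) δ) z
          (UnitaryGroup.toLocalRing E v b₂ * algebraMap E (UnitaryGroup.LocalRing E v) δ)
          (conjLocal_coord F E c hcδ v b₁) (conjLocal_coord F E c hcδ v b₂))))
    (he3mul : ∀ p p', e3 (p + p') = e3 p * e3 p')
    (ψ : AddChar (v.adicCompletion F) Circle) (hψ : Continuous ψ) {mψ : ℤ} (hmψ : ψ.HasConductorExp mψ) {σ : v.adicCompletion F} (hσ : σ ≠ 0)
    (w : PlacesOver E v) (hw : ∀ w' : PlacesOver E v, w' = w)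
    [MeasurableSpace (v.adicCompletion F)] [BorelSpace (v.adicCompletion F)] (μF : Measure (v.adicCompletion F)) [μF.IsAddHaarMeasure]
    [MeasurableSpace (w.1.adicCompletion E)] [BorelSpace (w.1.adicCompletion E)] (μw : Measure (w.1.adicCompletion E)) [μw.IsAddHaarMeasure]
    -- ANY place letter of ★ p29's shape (e.g. the one ★ `K2LiuKindOneSingularLocalFace` obtains): regular on `0 < re s`, the twisted big-cell integral on `1 < re s`
    (Gn' : ℂ → UnitaryGroup.localPi E c (2 + 2) J₂D v → ℂ)
    (hGn'reg : ∀ s₀ : ℂ, 0 < s₀.re → ∀ h, IsQRationalRegularAt (residueFieldCard (v.adicCompletion F)) s₀ (fun s => Gn' s h))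
    (hGn'int : ∀ s : ℂ, 1 < s.re → ∀ h : UnitaryGroup.localPi E c (2 + 2) J₂D v,
        ∫ u, conj ((ψ (σ * (e3.symm u).1) : ℂ)) * f s (FrameTransport.frameConj F E c v (2 + 2) hJ₂D (antidiagonal_over_eq_map F E 2) Q hQ (toLocalFour F E c v (weylSiegel (UnitaryGroup.LocalRing E v) (UnitaryGroup.conjLocal E c v))) * (u : UnitaryGroup.localPi E c (2 + 2) J₂D v) * h) ∂νN = Gn' s h) :
    ∃ (cN : ℝ≥0) (N₁ N₂ : ℂ → UnitaryGroup.localPi E c (2 + 2) J₂D v → ℂ),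
      (∀ (s₀ : ℂ) (g : UnitaryGroup.localPi E c (2 + 2) J₂D v),
        IsQRationalRegularAt (residueFieldCard (v.adicCompletion F)) s₀ (fun s => N₁ s g) ∧ IsQRationalRegularAt (residueFieldCard (v.adicCompletion F)) s₀ (fun s => N₂ s g)) ∧
      (∀ s : ℂ, (-1 : ℝ) / 2 < s.re → ∀ g : UnitaryGroup.localPi E c (2 + 2) J₂D v,
        Integrable (fun y => f s (FrameTransport.frameConj F E c v (2 + 2) hJ₂D (antidiagonal_over_eq_map F E 2) Q hQ (toLocalFour F E c v (weylTwo (UnitaryGroup.LocalRing E v) (UnitaryGroup.conjLocal E c v))) * FrameTransport.frameConj F E c v (2 + 2) hJ₂D (antidiagonal_over_eq_map F E 2) Q hQ (toLocalFour F E c v (uLongTwo (UnitaryGroup.LocalRing E v) (UnitaryGroup.conjLocal E c v) (UnitaryGroup.toLocalRing E v y * algebraMap E (UnitaryGroup.LocalRing E v) δ) (conjLocal_coord F E c hcδ v y))) * g)) μF ∧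
        N₁ s g = (lF F E v χv (2 * s + 1))⁻¹ * ∫ y, f s (FrameTransport.frameConj F E c v (2 + 2) hJ₂D (antidiagonal_over_eq_map F E 2) Q hQ (toLocalFour F E c v (weylTwo (UnitaryGroup.LocalRing E v) (UnitaryGroup.conjLocal E c v))) * FrameTransport.frameConj F E c v (2 + 2) hJ₂D (antidiagonal_over_eq_map F E 2) Q hQ (toLocalFour F E c v (uLongTwo (UnitaryGroup.LocalRing E v) (UnitaryGroup.conjLocal E c v) (UnitaryGroup.toLocalRing E v y * algebraMap E (UnitaryGroup.LocalRing E v) δ) (conjLocal_coord F E c hcδ v y))) * g) ∂μF) ∧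
      (∀ s : ℂ, 0 < s.re → ∀ g : UnitaryGroup.localPi E c (2 + 2) J₂D v,
        Integrable (fun ζ => N₁ s (FrameTransport.frameConj F E c v (2 + 2) hJ₂D (antidiagonal_over_eq_map F E 2) Q hQ (toLocalFour F E c v (weylOne (UnitaryGroup.LocalRing E v) (UnitaryGroup.conjLocal E c v))) * FrameTransport.frameConj F E c v (2 + 2) hJ₂D (antidiagonal_over_eq_map F E 2) Q hQ (toLocalFour F E c v (uMinus (UnitaryGroup.LocalRing E v) (UnitaryGroup.conjLocal E c v) (UnitaryGroup.conjLocal_conjLocal c v hcδ hδ) (Pi.single w ζ))) * g)) μw ∧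
        N₂ s g = (lEN F E c v χv (2 * s))⁻¹ * ∫ ζ, N₁ s (FrameTransport.frameConj F E c v (2 + 2) hJ₂D (antidiagonal_over_eq_map F E 2) Q hQ (toLocalFour F E c v (weylOne (UnitaryGroup.LocalRing E v) (UnitaryGroup.conjLocal E c v))) * FrameTransport.frameConj F E c v (2 + 2) hJ₂D (antidiagonal_over_eq_map F E 2) Q hQ (toLocalFour F E c v (uMinus (UnitaryGroup.LocalRing E v) (UnitaryGroup.conjLocal E c v) (UnitaryGroup.conjLocal_conjLocal c v hcδ hδ) (Pi.single w ζ))) * g) ∂μw) ∧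
      (∀ g : UnitaryGroup.localPi E c (2 + 2) J₂D v,
        N₂ (1 / 2) g = (lF F E v χv 2)⁻¹ * (lEN F E c v χv 1)⁻¹ *
          ∫ ζ, ∫ y, f (1 / 2) (FrameTransport.frameConj F E c v (2 + 2) hJ₂D (antidiagonal_over_eq_map F E 2) Q hQ (toLocalFour F E c v (weylTwo (UnitaryGroup.LocalRing E v) (UnitaryGroup.conjLocal E c v))) * FrameTransport.frameConj F E c v (2 + 2) hJ₂D (antidiagonal_over_eq_map F E 2) Q hQ (toLocalFour F E c v (uLongTwo (UnitaryGroup.LocalRing E v) (UnitaryGroup.conjLocal E c v) (UnitaryGroup.toLocalRing E v y * algebraMap E (UnitaryGroup.LocalRing E v) δ) (conjLocal_coord F E c hcδ v y))) *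
            (FrameTransport.frameConj F E c v (2 + 2) hJ₂D (antidiagonal_over_eq_map F E 2) Q hQ (toLocalFour F E c v (weylOne (UnitaryGroup.LocalRing E v) (UnitaryGroup.conjLocal E c v))) * FrameTransport.frameConj F E c v (2 + 2) hJ₂D (antidiagonal_over_eq_map F E 2) Q hQ (toLocalFour F E c v (uMinus (UnitaryGroup.LocalRing E v) (UnitaryGroup.conjLocal E c v) (UnitaryGroup.conjLocal_conjLocal c v hcδ hδ) (Pi.single w ζ))) * g)) ∂μF ∂μw) ∧
      ∀ h : UnitaryGroup.localPi E c (2 + 2) J₂D v, ∃ k₀ : ℕ, ∀ k : ℕ, k₀ ≤ k →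
        Gn' (1 / 2) h = ((cN : ℝ) : ℂ) *
          ∫ x in primePowBall (v.adicCompletion F) (-(k : ℤ)), conj ((ψ (σ * x) : ℂ)) *
            ∫ ζ, ∫ y, f (1 / 2) (FrameTransport.frameConj F E c v (2 + 2) hJ₂D (antidiagonal_over_eq_map F E 2) Q hQ (toLocalFour F E c v (weylTwo (UnitaryGroup.LocalRing E v) (UnitaryGroup.conjLocal E c v))) * FrameTransport.frameConj F E c v (2 + 2) hJ₂D (antidiagonal_over_eq_map F E 2) Q hQ (toLocalFour F E c v (uLongTwo (UnitaryGroup.LocalRing E v) (UnitaryGroup.conjLocal E c v) (UnitaryGroup.toLocalRing E v y * algebraMap E (UnitaryGroup.LocalRing E v) δ) (conjLocal_coord F E c hcδ v y))) *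
              (FrameTransport.frameConj F E c v (2 + 2) hJ₂D (antidiagonal_over_eq_map F E 2) Q hQ (toLocalFour F E c v (weylOne (UnitaryGroup.LocalRing E v) (UnitaryGroup.conjLocal E c v))) * FrameTransport.frameConj F E c v (2 + 2) hJ₂D (antidiagonal_over_eq_map F E 2) Q hQ (toLocalFour F E c v (uMinus (UnitaryGroup.LocalRing E v) (UnitaryGroup.conjLocal E c v) (UnitaryGroup.conjLocal_conjLocal c v hcδ hδ) (Pi.single w ζ))) *
                (FrameTransport.frameConj F E c v (2 + 2) hJ₂D (antidiagonal_over_eq_map F E 2) Q hQ (toLocalFour F E c v (weylTwo (UnitaryGroup.LocalRing E v) (UnitaryGroup.conjLocal E c v))) * FrameTransport.frameConj F E c v (2 + 2) hJ₂D (antidiagonal_over_eq_map F E 2) Q hQ (toLocalFour F E c v (uLongTwo (UnitaryGroup.LocalRing E v) (UnitaryGroup.conjLocal E c v) (UnitaryGroup.toLocalRing E v x * algebraMap E (UnitaryGroup.LocalRing E v) δ) (conjLocal_coord F E c hcδ v x))) * h))) ∂μF ∂μw ∂μF := by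
  obtain ⟨cN, N₁, N₂, hNreg, hA, hB, hball⟩ :=
    chainValues_of_placeLetter F E c hcδ hδ hd v hT₂ hJ₂D D Dinv hDD Q hQm hQ νN χv hχ K₀ hK₀ hIw f hSieg hsm hflat e3 he3 he3mul ψ hψ hmψ hσ w hw μF μw
      Gn' hGn'reg hGn'int
  exact ⟨cN, N₁, N₂, hNreg, hA, hB, fun g => stageB_half_eq_double_integral F E c hcδ hδ v hJ₂D Q hQ χv f w μF μw N₁ N₂ hA hB g,
    fun h => placeLetter_half_eq_corner_integral F E c hcδ hδ v hJ₂D Q hQ χv hχ f ψ σ w μF μw cN N₁ N₂ hA hB Gn' h (hball h)⟩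

/-! ## §2 Stage A at `½` from the Schrödinger-model word of `φ(w₂)·φ(u(yδ))` (hypothesis-first on [A1]∕[A2]) -/

omit [Algebra.IsQuadraticExtension F E] in
/-- **STAGE A AT `s₀ = ½` FROM THE MULTIPLIER WORD** (hypothesis-first on [A1]∕[A2]): if the section AT `½` satisfies, along the long-root corner
`φ(w₂)·φ(u_{2e₂}(ι y δ))·g`, the word `hword : f (1∕2) (…) = γ · ∫ x, Ψ x · ψ′(y · Q x) dμX^ι` — the value at `0` of
`γ₂ • (𝓕_{x′} ⊠ 1)(leviOpPi B₂ (unipOpPi (c_{t_y ⊗ 1}) (Γ ω(g) Φ)))` is such a Gauss transform of the `e₂`-block slice — then the (d′) letter of ★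
`chainValues_of_placeLetter` gives `N₁ (1∕2) g = L_F(2,χ_F)_v⁻¹ · γ · ∫_y (∫ x, Ψ x · ψ′(y · Q x) dμX^ι) dμF(y)`.  The letters `γ Ψ Q ψ′ μX` are free here.
[cite: Rangarao1993, Lemma 3.2 (3.8)] [cite: KudlaRallis1994, §2] -/
theorem stageA_half_of_word
    (χv : ∀ w : PlacesOver E v, (w.1.adicCompletion E)ˣ →* ℂˣ)
    (f : ℂ → UnitaryGroup.localPi E c (2 + 2) J₂D v → ℂ)
    [MeasurableSpace (v.adicCompletion F)] (μF : Measure (v.adicCompletion F))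
    (N₁ : ℂ → UnitaryGroup.localPi E c (2 + 2) J₂D v → ℂ)
    (hA : ∀ s : ℂ, (-1 : ℝ) / 2 < s.re → ∀ g : UnitaryGroup.localPi E c (2 + 2) J₂D v,
        Integrable (fun y => f s (FrameTransport.frameConj F E c v (2 + 2) hJ₂D (antidiagonal_over_eq_map F E 2) Q hQ (toLocalFour F E c v (weylTwo (UnitaryGroup.LocalRing E v) (UnitaryGroup.conjLocal E c v))) * FrameTransport.frameConj F E c v (2 + 2) hJ₂D (antidiagonal_over_eq_map F E 2) Q hQ (toLocalFour F E c v (uLongTwo (UnitaryGroup.LocalRing E v) (UnitaryGroup.conjLocal E c v) (UnitaryGroup.toLocalRing E v y * algebraMap E (UnitaryGroup.LocalRing E v) δ) (conjLocal_coord F E c hcδ v y))) * g)) μF ∧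
        N₁ s g = (lF F E v χv (2 * s + 1))⁻¹ * ∫ y, f s (FrameTransport.frameConj F E c v (2 + 2) hJ₂D (antidiagonal_over_eq_map F E 2) Q hQ (toLocalFour F E c v (weylTwo (UnitaryGroup.LocalRing E v) (UnitaryGroup.conjLocal E c v))) * FrameTransport.frameConj F E c v (2 + 2) hJ₂D (antidiagonal_over_eq_map F E 2) Q hQ (toLocalFour F E c v (uLongTwo (UnitaryGroup.LocalRing E v) (UnitaryGroup.conjLocal E c v) (UnitaryGroup.toLocalRing E v y * algebraMap E (UnitaryGroup.LocalRing E v) δ) (conjLocal_coord F E c hcδ v y))) * g) ∂μF)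
    (g : UnitaryGroup.localPi E c (2 + 2) J₂D v)
    -- the word letters: an index type, a base measure, a character, a scalar, a Schwartz–Bruhat slice, a phase function
    {ι : Type*} [Fintype ι] (μX : Measure (v.adicCompletion F)) (ψX : AddChar (v.adicCompletion F) Circle) (γ : ℂ)
    (Ψ : (ι → v.adicCompletion F) → ℂ) (Qf : (ι → v.adicCompletion F) → v.adicCompletion F)
    (hword : ∀ y : v.adicCompletion F,
      f (1 / 2) (FrameTransport.frameConj F E c v (2 + 2) hJ₂D (antidiagonal_over_eq_map F E 2) Q hQ (toLocalFour F E c v (weylTwo (UnitaryGroup.LocalRing E v) (UnitaryGroup.conjLocal E c v))) * FrameTransport.frameConj F E c v (2 + 2) hJ₂D (antidiagonal_over_eq_map F E 2) Q hQ (toLocalFour F E c v (uLongTwo (UnitaryGroup.LocalRing E v) (UnitaryGroup.conjLocal E c v) (UnitaryGroup.toLocalRing E v y * algebraMap E (UnitaryGroup.LocalRing E v) δ) (conjLocal_coord F E c hcδ v y))) * g) = γ * ∫ x, Ψ x * ((ψX (y * Qf x) : Circle) : ℂ) ∂(Measure.pi fun _ : ι => μX)) :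
    N₁ (1 / 2) g = (lF F E v χv 2)⁻¹ * (γ * ∫ y, ∫ x, Ψ x * ((ψX (y * Qf x) : Circle) : ℂ) ∂(Measure.pi fun _ : ι => μX) ∂μF) := by
  obtain ⟨-, hm, e1, -⟩ := half_re_facts
  rw [(hA (1 / 2) hm g).2, e1]
  congr 1
  rw [← integral_const_mul]
  exact integral_congr_ae (Filter.Eventually.of_forall hword)

/-! ## §3 Stage A at `½` as the fibre density of the null cone at its vertex (FILE 1 §1 through the word) -/

omit [Algebra.IsQuadraticExtension F E] in
/-- **STAGE A AT `s₀ = ½` IS `γ ∕ L_F(2)` TIMES THE FIBRE DENSITY OF THE NULL CONE `{Q = 0}` AT ITS VERTEX** (hypothesis-first on [A1]∕[A2], honest letters):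
for `Q` a quadratic form on `K^ι` (`K = F_v`) with non-degenerate polar form, `3 ≤ card ι`, `Ψ ∈ 𝒮(K^ι)`, `ψ′` of conductor exponent `d′`, `‖2‖ = q^{−v₂}`, the word
taken over the SAME Haar measure `μF` as stage A, and `hword` as in §2:
`Tendsto (k ↦ L_F(2)⁻¹ · γ · (selfDualConst μF d′ · μF(𝔭^k)⁻¹ · ∫ Ψ(x)·1_{𝔭^k}(Q x) dμF^ι)) atTop (𝓝 (N₁ (1∕2) g))` — Weil's Prop. 6 at `b₀ = 0` (FILE 1
`tendsto_ballAverage_nullCone`) through §2.  (For a word over another Haar measure `μX = r • μF` rescale `γ`.) [cite: Weil1965, Chap. III n° 36 Prop. 6, p. 54]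
[cite: KudlaRallis1994, §5 (5.3)–(5.6)] -/
theorem tendsto_ballAverage_stageA_half_of_word
    (χv : ∀ w : PlacesOver E v, (w.1.adicCompletion E)ˣ →* ℂˣ)
    (f : ℂ → UnitaryGroup.localPi E c (2 + 2) J₂D v → ℂ)
    [MeasurableSpace (v.adicCompletion F)] [BorelSpace (v.adicCompletion F)] (μF : Measure (v.adicCompletion F)) [μF.IsAddHaarMeasure]
    (N₁ : ℂ → UnitaryGroup.localPi E c (2 + 2) J₂D v → ℂ)
    (hA : ∀ s : ℂ, (-1 : ℝ) / 2 < s.re → ∀ g : UnitaryGroup.localPi E c (2 + 2) J₂D v,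
        Integrable (fun y => f s (FrameTransport.frameConj F E c v (2 + 2) hJ₂D (antidiagonal_over_eq_map F E 2) Q hQ (toLocalFour F E c v (weylTwo (UnitaryGroup.LocalRing E v) (UnitaryGroup.conjLocal E c v))) * FrameTransport.frameConj F E c v (2 + 2) hJ₂D (antidiagonal_over_eq_map F E 2) Q hQ (toLocalFour F E c v (uLongTwo (UnitaryGroup.LocalRing E v) (UnitaryGroup.conjLocal E c v) (UnitaryGroup.toLocalRing E v y * algebraMap E (UnitaryGroup.LocalRing E v) δ) (conjLocal_coord F E c hcδ v y))) * g)) μF ∧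
        N₁ s g = (lF F E v χv (2 * s + 1))⁻¹ * ∫ y, f s (FrameTransport.frameConj F E c v (2 + 2) hJ₂D (antidiagonal_over_eq_map F E 2) Q hQ (toLocalFour F E c v (weylTwo (UnitaryGroup.LocalRing E v) (UnitaryGroup.conjLocal E c v))) * FrameTransport.frameConj F E c v (2 + 2) hJ₂D (antidiagonal_over_eq_map F E 2) Q hQ (toLocalFour F E c v (uLongTwo (UnitaryGroup.LocalRing E v) (UnitaryGroup.conjLocal E c v) (UnitaryGroup.toLocalRing E v y * algebraMap E (UnitaryGroup.LocalRing E v) δ) (conjLocal_coord F E c hcδ v y))) * g) ∂μF)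
    (g : UnitaryGroup.localPi E c (2 + 2) J₂D v)
    {ι : Type*} [Fintype ι] {ψX : AddChar (v.adicCompletion F) Circle} {dX : ℤ} (hdX : ψX.HasConductorExp dX) {v₂ : ℤ}
    (h2 : normAbs (v.adicCompletion F) (2 : v.adicCompletion F) = (residueFieldCard (v.adicCompletion F) : ℝ≥0)⁻¹ ^ v₂) (γ : ℂ)
    (Qf : QuadraticForm (v.adicCompletion F) (ι → v.adicCompletion F)) (hQf : (QuadraticMap.associated (R := v.adicCompletion F) Qf).SeparatingLeft)
    {Ψ : (ι → v.adicCompletion F) → ℂ} (hΨ : Ψ ∈ SchwartzBruhat (ι → v.adicCompletion F)) (hr : 3 ≤ Fintype.card ι)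
    (hword : ∀ y : v.adicCompletion F,
      f (1 / 2) (FrameTransport.frameConj F E c v (2 + 2) hJ₂D (antidiagonal_over_eq_map F E 2) Q hQ (toLocalFour F E c v (weylTwo (UnitaryGroup.LocalRing E v) (UnitaryGroup.conjLocal E c v))) * FrameTransport.frameConj F E c v (2 + 2) hJ₂D (antidiagonal_over_eq_map F E 2) Q hQ (toLocalFour F E c v (uLongTwo (UnitaryGroup.LocalRing E v) (UnitaryGroup.conjLocal E c v) (UnitaryGroup.toLocalRing E v y * algebraMap E (UnitaryGroup.LocalRing E v) δ) (conjLocal_coord F E c hcδ v y))) * g) = γ * ∫ x, Ψ x * ((ψX (y * Qf x) : Circle) : ℂ) ∂(Measure.pi fun _ : ι => μF)) :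
    Tendsto (fun k : ℕ => (lF F E v χv 2)⁻¹ * γ * ((selfDualConst μF dX : ℂ) * (μF.real (primePowBall (v.adicCompletion F) k) : ℂ)⁻¹ *
        ∫ x, Ψ x * (primePowBall (v.adicCompletion F) (k : ℤ)).indicator (fun _ => (1 : ℂ)) (Qf x) ∂(Measure.pi fun _ : ι => μF))) atTop
      (𝓝 (N₁ (1 / 2) g)) := by
  rw [stageA_half_of_word F E c hcδ v hJ₂D Q hQ χv f μF N₁ hA g μF ψX γ Ψ Qf hword, ← mul_assoc]
  exact ((tendsto_ballAverage_nullCone μF hdX h2 Qf hQf hΨ hr).2).const_mul _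

end StageHalf

/-! ## §4 Unfolding Rao's multiplier word at a point: the integrand of ★ (M2a-C2a) ∕ [A1] §3 IS a Gauss-transform integrand (the shape of §2's `hword`) -/

section Unfold

open MeasureTheory Filter Matrix
open Literature.NumberTheory.GaloisRepresentations.IsNonarchimedeanLocalField
open Literature.NumberTheory.Automorphic Literature.RepresentationTheory.HeisenbergGroup

variable {K : Type*} [Field K] [ValuativeRel K] [TopologicalSpace K] [IsNonarchimedeanLocalField K] [Invertible (2 : K)]
variable {ι κ : Type*} [Fintype ι] [Fintype κ] [MeasurableSpace K] (μ : Measure K) {ψ : AddChar K Circle}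

/-- **RAO'S MULTIPLIER WORD, INTEGRATED ALONG A SLICE, IS A GAUSS TRANSFORM**: for `c` linear on `K^κ`, `Θ ∈ 𝒮(K^κ)`, any slice map `L : K^ι → K^κ` (e.g. `x₁ ↦ x₁ ⊔ 0` of ★
`K2LiuTensorMiddleCellHaarDelta.exists_ne_zero_swSectionTensorLoc_flip_mul_nElem_eq_integral`) and `y ∈ K`,
`∫ x, (unipOpPi (y • c) Θ)(L x) dμ^ι = ∫ x, Θ(L x) · ψ(y · (−½⟨L x, c (L x)⟩)) dμ^ι` (★ `coe_unipOpPi_apply`, `halfForm (y • c) = y · halfForm c`) — i.e. the word's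
`y`-dependence is EXACTLY §2's `hword` integrand with `Ψ := Θ ∘ L`, `ψ′ := ψ`, `Q := −halfForm c ∘ L` (a quadratic form when `L` is linear).
[cite: Rangarao1993, Lemma 3.2 (3.8)] -/
theorem integral_coe_unipOpPi_smul_comp (hl : IsLocallyConstant (⇑ψ : K → Circle)) (c : (κ → K) →ₗ[K] (κ → K)) (Θ : SchwartzBruhat (κ → K))
    (L : (ι → K) → (κ → K)) (y : K) :
    ∫ x, ((unipOpPi hl (y • c) Θ : SchwartzBruhat (κ → K)) : (κ → K) → ℂ) (L x) ∂(Measure.pi fun _ : ι => μ) =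
      ∫ x, ((Θ : SchwartzBruhat (κ → K)) : (κ → K) → ℂ) (L x) * ((ψ (y * -halfForm c (L x)) : Circle) : ℂ) ∂(Measure.pi fun _ : ι => μ) := by
  refine integral_congr_ae (Eventually.of_forall fun x => ?_)
  have hs : halfForm (y • c) (L x) = y * halfForm c (L x) := by
    rw [halfForm_apply, halfForm_apply, LinearMap.smul_apply, dotProduct_smul, smul_eq_mul]
    ring
  dsimp only
  rw [coe_unipOpPi_apply, hs, mul_comm, ← mul_neg]

end Unfold

end Summit.HodgeConjecture.HodgeConjecture.Cruxes.HLiu418.K2LiuRankOneStageIntegralsAtHalfWords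

end
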